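import Summits.KontsevichZagierPeriods.KontsevichZagierPeriods.Theorems.LiouvilleUnfoldingAyoubPiLocalKernelNilCut
import Summits.KontsevichZagierPeriods.KontsevichZagierPeriods.Theorems.ReducedPeriodRing.Negative.RingForms

/-!
# The transcendence-free half (R) of the nilradical cut of item stmt-KontsevichZagierPeriods-0541
# (`LiouvilleUnfolding.AyoubPiLocalKernel`): reductions

Support file (`--supports` stmt-KontsevichZagierPeriods-0541) for the line `SketchIdeator2` (card
`nilradical-cut`), stub `stub_locallyReducedOnTorsion`.  Notation: `P := KZ.FormalPeriodRing = FormalRep ⧸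
relations` (commutative), `p := KZ.toFormalPeriod (KZ.of KZ.piRep)` the class of the disc (`evalP p = π`),
`P[p⁻¹] := Localization.Away p`.  The stub is

  (R)  `∀ x : P, (∃ N k, p ^ N * x ^ (k + 1) = 0) → ∃ N, p ^ N * x = 0`

("a `p`-locally nilpotent class is `p`-power torsion").  It is OPEN for the four-move calculus (nothing in
print proves it; its motivic shadow — nilpotents of the effective period algebra die when `2πi` is
inverted — is Cartier smoothness of the localised torsor, Huber–Müller-Stach Rem. 13.2.4).  This file does
NOT prove (R); it places it exactly, by pure commutative algebra over tree declarations: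

* `locallyReducedOnTorsion_iff_isReduced_away` (registered sub-goal of the line) — (R) `↔ IsReduced P[p⁻¹]`,
  i.e. (R) is reducedness of Kontsevich–Zagier's extended algebra `P̂ = P[π⁻¹]` in the rules presentation;
* `locallyReducedOnTorsion_iff_ker_isRadical` — (R) `↔` the `p`-power-torsion ideal
  `ker (P → P[p⁻¹])` is a radical ideal;
* `locallyReducedOnTorsion_of_isReduced`, `locallyReducedOnTorsion_of_reducedPeriodRing` — (R) follows
  from `IsReduced P`, i.e. from item stmt-KontsevichZagierPeriods-3929 (`FurushoPentagon.ReducedPeriodRing`,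
  open crux): `(p ^ N * x) ^ (k + 1) = (p ^ N) ^ k * (p ^ N * x ^ (k + 1)) = 0`;
* `locallyReducedOnTorsion_iff_sq` — it suffices to treat squares: (R) `↔ ∀ x, (∃ N, p ^ N * x ^ 2 = 0) →
  ∃ N, p ^ N * x = 0` (descent `(p ^ N * x ^ (k + 1)) ^ 2 = p ^ N * x ^ k * (p ^ N * x ^ (k + 2))`);
* `locallyReducedOnTorsion_iff_nilIsPiTorsion` — (R) `↔ ∀ c : FormalRep, c * c ∈ relations →
  ∃ N, ([π] * ·)^[N] c ∈ relations`, the closed-term child `NilIsPiTorsion` of crux stmt-3929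
  (`Cruxes/ReducedPeriodRing/SplitGlue.lean`), so the two programmes share this half verbatim;
* `ayoubPiLocalKernel_of_nil_of_reducedPeriodRing`, `ayoubPiLocalKernel_iff_nil_and_nilIsPiTorsion`,
  `isReduced_away_of_summit` — bookkeeping: item 0541 `⟸` (N) ∧ item 3929, item 0541 `↔` (N) ∧
  `NilIsPiTorsion`, and the summit makes `P[p⁻¹]` reduced.

Nothing conjecture-grade is asserted and no definition is introduced.  References: M. Kontsevich, D. Zagier,
*Periods* (2001), §4.1 (`P̂ = P[(2πi)⁻¹]`); J. Ayoub, EMS Newsl. 91 (2014), Def. 6, Conj. 7; A. Huber,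
S. Müller-Stach, *Periods and Nori Motives* (2017), Rem. 13.2.4, Conj. 13.2.5.  Mathlib:
`IsLocalization.map_eq_zero_iff`, `IsLocalization.mk'_surjective`, `IsLocalization.mk'_eq_zero_iff`,
`IsLocalization.mk'_spec`, `Commute.isNilpotent_mul_right`, `Ideal.IsRadical`.
-/

noncomputable section

open Literature.NumberTheory.Transcendental

namespace Summit.KontsevichZagierPeriods.LiouvilleUnfolding.NilradicalCut

open Summit.KontsevichZagierPeriods.LiouvilleUnfolding.PiLocalKernelPosition
open Summit.KontsevichZagierPeriods.KontsevichZagierPeriods.Theses.LiouvilleUnfolding (AyoubPiLocalKernel)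
open Summit.KontsevichZagierPeriods.KontsevichZagierPeriods.Theses.FurushoPentagon (ReducedPeriodRing)
open Summit.KontsevichZagierPeriods.KontsevichZagierPeriods.ReducedPeriodRingNegative
  (reducedPeriodRing_iff_isReduced)

/-! ## `p`-power torsion is the kernel of `P → P[p⁻¹]` -/

/-- `x` is `p`-power torsion in `P` iff its image in `P[p⁻¹]` vanishes (`IsLocalization.map_eq_zero_iff`).
[folklore] -/
theorem piTorsion_iff_algebraMap_eq_zero (x : KZ.FormalPeriodRing) :
    (∃ N : ℕ, KZ.toFormalPeriod (KZ.of KZ.piRep) ^ N * x = 0) ↔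
      algebraMap KZ.FormalPeriodRing (Localization.Away (KZ.toFormalPeriod (KZ.of KZ.piRep))) x = 0 := by
  rw [IsLocalization.map_eq_zero_iff (Submonoid.powers (KZ.toFormalPeriod (KZ.of KZ.piRep)))]
  constructor
  · rintro ⟨N, hN⟩
    exact ⟨⟨_, N, rfl⟩, hN⟩
  · rintro ⟨⟨m, N, rfl⟩, hm⟩
    exact ⟨N, hm⟩

/-! ## (R) is reducedness of `P[p⁻¹]` (registered sub-goal) -/

/-- **(R) `↔ IsReduced P[p⁻¹]`.** `→`: an element of `P[p⁻¹]` is `x / s` with `s` a power of `p`; if it is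
nilpotent then so is `x / 1 = (x / s) · s`, i.e. `p ^ N * x ^ (k + 1) = 0` in `P` for some `N k`
(`locallyNil_iff_isNilpotent_algebraMap`), so (R) gives `p ^ M * x = 0`, i.e. `x / s = 0`
(`IsLocalization.mk'_eq_zero_iff`). `←`: a `p`-locally nilpotent `x` has nilpotent, hence zero, image in
`P[p⁻¹]`, i.e. is `p`-power torsion (`IsLocalization.map_eq_zero_iff`). This is reducedness of
Kontsevich–Zagier's extended algebra `P̂ = P[π⁻¹]` in the rules presentation. [cite: KontsevichZagier2001, §4.1] -/
theorem locallyReducedOnTorsion_iff_isReduced_away : (∀ x : KZ.FormalPeriodRing, (∃ N k : ℕ, KZ.toFormalPeriod (KZ.of KZ.piRep) ^ N * x ^ (k + 1) = 0) → ∃ N : ℕ, KZ.toFormalPeriod (KZ.of KZ.piRep) ^ N * x = 0) ↔ IsReduced (Localization.Away (KZ.toFormalPeriod (KZ.of KZ.piRep))) := by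
  set p := KZ.toFormalPeriod (KZ.of KZ.piRep) with hp
  constructor
  · intro h
    refine ⟨fun y hy => ?_⟩
    obtain ⟨⟨x, s⟩, rfl⟩ := IsLocalization.mk'_surjective (Submonoid.powers p) y
    simp only at hy ⊢
    have hx : IsNilpotent (algebraMap KZ.FormalPeriodRing (Localization.Away p) x) := by
      rw [← IsLocalization.mk'_spec (Localization.Away p) x s]
      exact Commute.isNilpotent_mul_right (Commute.all _ _) hy
    obtain ⟨N, hN⟩ := h x ((locallyNil_iff_isNilpotent_algebraMap x).mpr hx)
    exact (IsLocalization.mk'_eq_zero_iff x s).mpr ⟨⟨_, N, rfl⟩, hN⟩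
  · intro h x hx
    exact (piTorsion_iff_algebraMap_eq_zero x).mpr
      (h.eq_zero _ ((locallyNil_iff_isNilpotent_algebraMap x).mp hx))

/-- **(R) `↔` the `p`-power-torsion ideal `ker (P → P[p⁻¹])` is radical**: `x ^ n ∈ ker` says the image
of `x` in `P[p⁻¹]` is nilpotent, i.e. `x` is `p`-locally nilpotent; `x ∈ ker` says `x` is `p`-power torsion.
[folklore] -/
theorem locallyReducedOnTorsion_iff_ker_isRadical :
    (∀ x : KZ.FormalPeriodRing,
        (∃ N k : ℕ, KZ.toFormalPeriod (KZ.of KZ.piRep) ^ N * x ^ (k + 1) = 0) →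
          ∃ N : ℕ, KZ.toFormalPeriod (KZ.of KZ.piRep) ^ N * x = 0) ↔
      (RingHom.ker (algebraMap KZ.FormalPeriodRing
        (Localization.Away (KZ.toFormalPeriod (KZ.of KZ.piRep))))).IsRadical := by
  constructor
  · rintro h x ⟨n, hn⟩
    rw [RingHom.mem_ker, map_pow] at hn
    rw [RingHom.mem_ker, ← piTorsion_iff_algebraMap_eq_zero]
    exact h x ((locallyNil_iff_isNilpotent_algebraMap x).mpr ⟨n, hn⟩)
  · intro h x hx
    rw [piTorsion_iff_algebraMap_eq_zero, ← RingHom.mem_ker]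
    obtain ⟨n, hn⟩ := (locallyNil_iff_isNilpotent_algebraMap x).mp hx
    exact h ⟨n, by rwa [RingHom.mem_ker, map_pow]⟩

/-! ## (R) from reducedness of `P` (item stmt-KontsevichZagierPeriods-3929) -/

/-- **`IsReduced P ⇒` (R)**: if `p ^ N * x ^ (k + 1) = 0` then `(p ^ N * x) ^ (k + 1) =
(p ^ N) ^ k * (p ^ N * x ^ (k + 1)) = 0`, so `p ^ N * x` is nilpotent, hence `0`. [folklore] -/
theorem locallyReducedOnTorsion_of_isReduced (h : IsReduced KZ.FormalPeriodRing) :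
    ∀ x : KZ.FormalPeriodRing,
      (∃ N k : ℕ, KZ.toFormalPeriod (KZ.of KZ.piRep) ^ N * x ^ (k + 1) = 0) →
        ∃ N : ℕ, KZ.toFormalPeriod (KZ.of KZ.piRep) ^ N * x = 0 := by
  rintro x ⟨N, k, hNk⟩
  refine ⟨N, h.eq_zero _ ⟨k + 1, ?_⟩⟩
  calc (KZ.toFormalPeriod (KZ.of KZ.piRep) ^ N * x) ^ (k + 1)
      = (KZ.toFormalPeriod (KZ.of KZ.piRep) ^ N) ^ k *
          (KZ.toFormalPeriod (KZ.of KZ.piRep) ^ N * x ^ (k + 1)) := by ring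
    _ = 0 := by rw [hNk, mul_zero]

/-- **Item stmt-KontsevichZagierPeriods-3929 `⇒` (R)**: the crux `ReducedPeriodRing` of route FurushoPentagon
is `IsReduced P` (`reducedPeriodRing_iff_isReduced`), and a reduced ring has reduced localisations. So the
stub is implied by an existing (open) named item; it is NOT known to imply it back (the difference is
`[π]`-cancellation on nilpotents, cf. `Cruxes/ReducedPeriodRing/SplitGlue.lean`). [folklore] -/
theorem locallyReducedOnTorsion_of_reducedPeriodRing (h : ReducedPeriodRing) :
    ∀ x : KZ.FormalPeriodRing,
      (∃ N k : ℕ, KZ.toFormalPeriod (KZ.of KZ.piRep) ^ N * x ^ (k + 1) = 0) →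
        ∃ N : ℕ, KZ.toFormalPeriod (KZ.of KZ.piRep) ^ N * x = 0 :=
  locallyReducedOnTorsion_of_isReduced (reducedPeriodRing_iff_isReduced.mp h)

/-- The same in the localised ring: item 3929 makes `P[p⁻¹]` reduced. [folklore] -/
theorem isReduced_away_of_reducedPeriodRing (h : ReducedPeriodRing) :
    IsReduced (Localization.Away (KZ.toFormalPeriod (KZ.of KZ.piRep))) :=
  locallyReducedOnTorsion_iff_isReduced_away.mp (locallyReducedOnTorsion_of_reducedPeriodRing h)

/-- The summit makes `P[p⁻¹]` reduced (via `nil_and_locallyReduced_of_summit`). [cite: KontsevichZagier2001, §1.2 Conjecture 1] -/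
theorem isReduced_away_of_summit (h : KontsevichZagierPeriods) :
    IsReduced (Localization.Away (KZ.toFormalPeriod (KZ.of KZ.piRep))) :=
  locallyReducedOnTorsion_iff_isReduced_away.mp (nil_and_locallyReduced_of_summit h).2

/-! ## It suffices to treat squares -/

/-- **(R) `↔` its square case**: `∀ x, (∃ N, p ^ N * x ^ 2 = 0) → ∃ N, p ^ N * x = 0`. `←` by descent on
`k`: from `p ^ N * x ^ (k + 2) = 0` the class `y := p ^ N * x ^ (k + 1)` satisfies
`y ^ 2 = p ^ N * x ^ k * (p ^ N * x ^ (k + 2)) = 0`, so `p ^ M * y = p ^ (M + N) * x ^ (k + 1) = 0` and the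
exponent has dropped. [folklore] -/
theorem locallyReducedOnTorsion_iff_sq :
    (∀ x : KZ.FormalPeriodRing,
        (∃ N k : ℕ, KZ.toFormalPeriod (KZ.of KZ.piRep) ^ N * x ^ (k + 1) = 0) →
          ∃ N : ℕ, KZ.toFormalPeriod (KZ.of KZ.piRep) ^ N * x = 0) ↔
      ∀ x : KZ.FormalPeriodRing,
        (∃ N : ℕ, KZ.toFormalPeriod (KZ.of KZ.piRep) ^ N * x ^ 2 = 0) →
          ∃ N : ℕ, KZ.toFormalPeriod (KZ.of KZ.piRep) ^ N * x = 0 := by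
  set p := KZ.toFormalPeriod (KZ.of KZ.piRep) with hp
  constructor
  · rintro h x ⟨N, hN⟩
    exact h x ⟨N, 1, hN⟩
  · intro h2
    suffices key : ∀ (k : ℕ) (x : KZ.FormalPeriodRing) (N : ℕ),
        p ^ N * x ^ (k + 1) = 0 → ∃ M : ℕ, p ^ M * x = 0 by
      rintro x ⟨N, k, hNk⟩
      exact key k x N hNk
    intro k
    induction k with
    | zero =>
      intro x N h
      exact ⟨N, by rwa [zero_add, pow_one] at h⟩
    | succ k ih =>
      intro x N h
      obtain ⟨M, hM⟩ := h2 (p ^ N * x ^ (k + 1)) ⟨0, by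
        rw [pow_zero, one_mul]
        calc (p ^ N * x ^ (k + 1)) ^ 2 = p ^ N * x ^ k * (p ^ N * x ^ (k + 1 + 1)) := by ring
          _ = 0 := by rw [h, mul_zero]⟩
      exact ih x (M + N) (by rw [pow_add, mul_assoc]; exact hM)

/-! ## (R) is the closed-term child `NilIsPiTorsion` of crux stmt-KontsevichZagierPeriods-3929 -/

/-- **(R) `↔ NilIsPiTorsion`** (closed-term form over `FormalRep`, as in
`Cruxes/ReducedPeriodRing/SplitGlue.lean`): every `c` with `c * c ∈ relations` becomes a relation after
finitely many multiplications by the disc `[π]`. `→`: `⟦c⟧ ^ 2 = 0`, so `p ^ N * ⟦c⟧ = ⟦([π] * ·)^[N] c⟧ = 0`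
(`toFormalPeriod_iterate_piRep_mul`). `←`: by `locallyReducedOnTorsion_iff_sq` it suffices to treat
`p ^ N * ⟦c⟧ ^ 2 = 0`; then `d := ([π] * ·)^[N] c` has `⟦d * d⟧ = p ^ N * (p ^ N * ⟦c⟧ ^ 2) = 0`, so some
`([π] * ·)^[M] d` is a relation, i.e. `p ^ (M + N) * ⟦c⟧ = 0`. [cite: KontsevichZagier2001, §4.1] -/
theorem locallyReducedOnTorsion_iff_nilIsPiTorsion :
    (∀ x : KZ.FormalPeriodRing,
        (∃ N k : ℕ, KZ.toFormalPeriod (KZ.of KZ.piRep) ^ N * x ^ (k + 1) = 0) →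
          ∃ N : ℕ, KZ.toFormalPeriod (KZ.of KZ.piRep) ^ N * x = 0) ↔
      ∀ c : KZ.FormalRep, c * c ∈ KZ.relations →
        ∃ N : ℕ, (fun x => KZ.of KZ.piRep * x)^[N] c ∈ KZ.relations := by
  set p := KZ.toFormalPeriod (KZ.of KZ.piRep) with hp
  constructor
  · intro h c hc
    obtain ⟨N, hN⟩ := h (KZ.toFormalPeriod c) ⟨0, 1, by
      rw [pow_zero, one_mul, pow_succ, pow_one, ← map_mul, KZ.toFormalPeriod_eq_zero_iff]
      exact hc⟩
    exact ⟨N, by rw [← KZ.toFormalPeriod_eq_zero_iff, toFormalPeriod_iterate_piRep_mul]; exact hN⟩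
  · intro h
    rw [locallyReducedOnTorsion_iff_sq]
    rintro x ⟨N, hN⟩
    obtain ⟨c, rfl⟩ := KZ.toFormalPeriod_surjective x
    have hd : KZ.toFormalPeriod ((fun x => KZ.of KZ.piRep * x)^[N] c) = p ^ N * KZ.toFormalPeriod c :=
      toFormalPeriod_iterate_piRep_mul N c
    have hdd : (fun x => KZ.of KZ.piRep * x)^[N] c * (fun x => KZ.of KZ.piRep * x)^[N] c ∈
        KZ.relations := by
      rw [← KZ.toFormalPeriod_eq_zero_iff, map_mul, hd]
      calc p ^ N * KZ.toFormalPeriod c * (p ^ N * KZ.toFormalPeriod c)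
          = p ^ N * (p ^ N * KZ.toFormalPeriod c ^ 2) := by ring
        _ = 0 := by rw [hN, mul_zero]
    obtain ⟨M, hM⟩ := h _ hdd
    refine ⟨M + N, ?_⟩
    rw [← KZ.toFormalPeriod_eq_zero_iff, toFormalPeriod_iterate_piRep_mul, hd, ← mul_assoc,
      ← pow_add] at hM
    exact hM

/-! ## Bookkeeping for the line -/

/-- **Item 0541 `⟸` (N) ∧ item 3929**: the transcendence half of the cut together with reducedness of the
formal period ring prove the route decl `AyoubPiLocalKernel`. [folklore] -/
theorem ayoubPiLocalKernel_of_nil_of_reducedPeriodRing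
    (hN : ∀ x : KZ.FormalPeriodRing, KZ.evalP x = 0 →
      ∃ N k : ℕ, KZ.toFormalPeriod (KZ.of KZ.piRep) ^ N * x ^ (k + 1) = 0)
    (hR : ReducedPeriodRing) : AyoubPiLocalKernel :=
  ayoubPiLocalKernel_of_nil_of_locallyReduced hN (locallyReducedOnTorsion_of_reducedPeriodRing hR)

/-- **Item 0541 `↔` (N) ∧ `NilIsPiTorsion`**: the exact cut with its transcendence-free half written as the
closed-term child of crux 3929. [folklore] -/
theorem ayoubPiLocalKernel_iff_nil_and_nilIsPiTorsion :
    AyoubPiLocalKernel ↔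
      ((∀ x : KZ.FormalPeriodRing, KZ.evalP x = 0 →
          ∃ N k : ℕ, KZ.toFormalPeriod (KZ.of KZ.piRep) ^ N * x ^ (k + 1) = 0) ∧
        ∀ c : KZ.FormalRep, c * c ∈ KZ.relations →
          ∃ N : ℕ, (fun x => KZ.of KZ.piRep * x)^[N] c ∈ KZ.relations) := by
  rw [ayoubPiLocalKernel_iff_nil_and_locallyReduced, locallyReducedOnTorsion_iff_nilIsPiTorsion]

end Summit.KontsevichZagierPeriods.LiouvilleUnfolding.NilradicalCut

end
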